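/-
Copyright: the b2b-balaban T⁴-continuum CRUX team, row NE7b OWNER lineage `t4-ne7b-p1` (gen 144). Project licence.
-/
import Summits.QuantumFields.BalabanUV.T4Continuum.Spine.NE7b.SupFourthKernelEntryLettersOne
import Summits.QuantumFields.BalabanUV.T4Continuum.Spine.NE7b.SupFifthKernelTwoPointLetters

/-!
# TOOLBOX FOR THE DISPLAY-INDEX SLOT LETTERS OF THE ORDER-FIVE ENTRY MAJORANT (the order-5 block of the kernel-letter CLASS MAP; finite sums;
# the analogue of (527)∕(528) §1).  (612) bounded `Σ_{y,z,t,s}M` (row index fixed); the other four slot letters (`k5r⁺, k5s2⁺, k5s3⁺, k5s4⁺`: a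
# display index fixed, the row index `x` summed) need, for the fifteen two-point terms `E(p^I, q^J) = Σ_w(Dᵀp)_w(Dᵀq)_w∕c`, a master with the
# MASS letter of the family containing the fixed slot (free indices `m = 0…3`) against the COLUMN letter of the other family (`n = 4 − m` free
# indices): §2 the masters at the arities `m + n = 4` in both factor orders (from (527) `master_two_point(_rev)` and (528) `master_single(_rev)′`
# by `Fintype.sum_prod_type`); §1 the `K5`-vector masses with the second, third or fourth index fixed (input letters `k5s2, k5s3, k5s4` —
# (564) has the first index and the column); §3 the seven quadruple-sum reindexings (595) lacks (row NE7b, node U5c; (527), (528), (564) BY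
# NAME; [folklore] finite sums)

Cell `pub-balaban`, sub-cell `t4`, spine estimate NE7b (`T4WeightBudget.RelWeightBound`; the cell's OWN estimate — NOT PRINTED in
[Bałaban 1983–89], NOT PROVED).  Crux-route work under `Spine/NE7b/` by the row OWNER (`t4-ne7b-p1` gen 144, file (613)) under FREEZE
(0)'s crux-prover clause; NOTHING of Bałaban's is named as a Lean object, valued or asserted; no `T4Continuum/Support` leaf typed; no
`def`, no notation; zero `sorry`.  Imports (BY NAME): the OWNER's (528) `…SupFourthKernelEntryLettersOne` ((527) through it), (564).

WHAT IS PROVED ([folklore]): §1 `fourth_vector_mass_two`, `fourth_vector_mass_three`, `fourth_vector_mass_four`; §2 `master31`, `master31_rev`,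
`master22`, `master22_rev`, `master13`, `master13_rev`, `master04`, `master04_rev`; §3 `sum4_<perm>` for the seven remaining permutations; toy.

HONEST (what this is NOT).  Finite-sum tools; the support-counted star∕tree sums with a LEG or RIDER index fixed (the `Hk`∕`K3` support counts
in their other index roles) and the four slot files themselves are the next files (memo SCOPING-d16).  Scalar skeleton ((A3), NC-NE7b-α
UNRULED); nothing of Bałaban's asserted.  BY-NAME EFFECT ON THE WALL: NONE.  NE7b NOT PRINTED ∕ NOT PROVED; spine PROVED 0∕9; rung (B)+1 — the
programme's measures remain FINITE-torus statements; NOT the mass gap, NOT Clay.  HONEST DEPENDENCY: continuum YM on T⁴ ⇐ BetaPertH ∧ nine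
spine estimates (0∕9 proved); BetaPertH ⇐ (D1) ∧ (D4) ∧ CAP+tail; G-an2-4 gates asym, D1 and NE2∕3∕4.
-/

set_option autoImplicit false

noncomputable section

namespace Summit.QuantumFields.BalabanUV.T4Continuum.NE7b.SupFifthKernelSlotMasters

open Finset Real Matrix
open scoped BigOperators
open SupFourthKernelSlotSums (master_two_point master_two_point_rev)
open SupFourthKernelEntryLettersOne (master_single' master_single_rev')

variable {ι κ : Type} [Fintype ι] [DecidableEq ι] [Fintype κ] [DecidableEq κ]

/-! ## §1. The `K5`-vector masses with an inner index fixed -/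

section Masses

variable {A : Matrix ι κ ℝ} {K5 : ι → ι → ι → ι → ι → ℝ} {αr k5s2 k5s3 k5s4 : ℝ}

omit [DecidableEq ι] [DecidableEq κ] in
/-- **The `K5`-vector mass with the SECOND index fixed**: `Σ_{x,z,t}Σ_w k5^{xyzt}_w ≤ αr·k5s2` (input letter `k5s2 : ∀ y, Σ_xΣ_zΣ_tΣ_u K5 x y z t
u`). [folklore] -/
theorem fourth_vector_mass_two (hK50 : ∀ x y z t u, 0 ≤ K5 x y z t u) (hαr : ∀ u, ∑ w, |A u w| ≤ αr)
    (hk5s2 : ∀ y, ∑ x, ∑ z, ∑ t, ∑ u, K5 x y z t u ≤ k5s2) (y : ι) : ∑ x, ∑ z, ∑ t, ∑ w, ∑ u, |A u w| * K5 x y z t u ≤ αr * k5s2 := by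
  rcases isEmpty_or_nonempty ι with hι | ⟨⟨u₀⟩⟩
  · exact (hι.false y).elim
  have hαr0 : 0 ≤ αr := (Finset.sum_nonneg fun w _ => abs_nonneg (A u₀ w)).trans (hαr u₀)
  have hin : ∀ x z t, ∑ w, ∑ u, |A u w| * K5 x y z t u ≤ αr * ∑ u, K5 x y z t u := fun x z t => by
    rw [Finset.sum_comm, Finset.mul_sum]
    refine Finset.sum_le_sum fun u _ => ?_
    calc ∑ w, |A u w| * K5 x y z t u = (∑ w, |A u w|) * K5 x y z t u := (Finset.sum_mul _ _ _).symm
      _ ≤ αr * K5 x y z t u := mul_le_mul_of_nonneg_right (hαr u) (hK50 x y z t u)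
  calc ∑ x, ∑ z, ∑ t, ∑ w, ∑ u, |A u w| * K5 x y z t u ≤ ∑ x, ∑ z, ∑ t, αr * ∑ u, K5 x y z t u :=
        Finset.sum_le_sum fun _ _ => Finset.sum_le_sum fun _ _ => Finset.sum_le_sum fun _ _ => hin _ _ _
    _ = αr * ∑ x, ∑ z, ∑ t, ∑ u, K5 x y z t u := by simp only [Finset.mul_sum]
    _ ≤ αr * k5s2 := mul_le_mul_of_nonneg_left (hk5s2 y) hαr0

omit [DecidableEq ι] [DecidableEq κ] in
/-- **The `K5`-vector mass with the THIRD index fixed**: `≤ αr·k5s3` (`k5s3 : ∀ z, Σ_xΣ_yΣ_tΣ_u K5 x y z t u`). [folklore] -/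
theorem fourth_vector_mass_three (hK50 : ∀ x y z t u, 0 ≤ K5 x y z t u) (hαr : ∀ u, ∑ w, |A u w| ≤ αr)
    (hk5s3 : ∀ z, ∑ x, ∑ y, ∑ t, ∑ u, K5 x y z t u ≤ k5s3) (z : ι) : ∑ x, ∑ y, ∑ t, ∑ w, ∑ u, |A u w| * K5 x y z t u ≤ αr * k5s3 := by
  rcases isEmpty_or_nonempty ι with hι | ⟨⟨u₀⟩⟩
  · exact (hι.false z).elim
  have hαr0 : 0 ≤ αr := (Finset.sum_nonneg fun w _ => abs_nonneg (A u₀ w)).trans (hαr u₀)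
  have hin : ∀ x y t, ∑ w, ∑ u, |A u w| * K5 x y z t u ≤ αr * ∑ u, K5 x y z t u := fun x y t => by
    rw [Finset.sum_comm, Finset.mul_sum]
    refine Finset.sum_le_sum fun u _ => ?_
    calc ∑ w, |A u w| * K5 x y z t u = (∑ w, |A u w|) * K5 x y z t u := (Finset.sum_mul _ _ _).symm
      _ ≤ αr * K5 x y z t u := mul_le_mul_of_nonneg_right (hαr u) (hK50 x y z t u)
  calc ∑ x, ∑ y, ∑ t, ∑ w, ∑ u, |A u w| * K5 x y z t u ≤ ∑ x, ∑ y, ∑ t, αr * ∑ u, K5 x y z t u :=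
        Finset.sum_le_sum fun _ _ => Finset.sum_le_sum fun _ _ => Finset.sum_le_sum fun _ _ => hin _ _ _
    _ = αr * ∑ x, ∑ y, ∑ t, ∑ u, K5 x y z t u := by simp only [Finset.mul_sum]
    _ ≤ αr * k5s3 := mul_le_mul_of_nonneg_left (hk5s3 z) hαr0

omit [DecidableEq ι] [DecidableEq κ] in
/-- **The `K5`-vector mass with the FOURTH index fixed**: `≤ αr·k5s4` (`k5s4 : ∀ t, Σ_xΣ_yΣ_zΣ_u K5 x y z t u`). [folklore] -/
theorem fourth_vector_mass_four (hK50 : ∀ x y z t u, 0 ≤ K5 x y z t u) (hαr : ∀ u, ∑ w, |A u w| ≤ αr)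
    (hk5s4 : ∀ t, ∑ x, ∑ y, ∑ z, ∑ u, K5 x y z t u ≤ k5s4) (t : ι) : ∑ x, ∑ y, ∑ z, ∑ w, ∑ u, |A u w| * K5 x y z t u ≤ αr * k5s4 := by
  rcases isEmpty_or_nonempty ι with hι | ⟨⟨u₀⟩⟩
  · exact (hι.false t).elim
  have hαr0 : 0 ≤ αr := (Finset.sum_nonneg fun w _ => abs_nonneg (A u₀ w)).trans (hαr u₀)
  have hin : ∀ x y z, ∑ w, ∑ u, |A u w| * K5 x y z t u ≤ αr * ∑ u, K5 x y z t u := fun x y z => by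
    rw [Finset.sum_comm, Finset.mul_sum]
    refine Finset.sum_le_sum fun u _ => ?_
    calc ∑ w, |A u w| * K5 x y z t u = (∑ w, |A u w|) * K5 x y z t u := (Finset.sum_mul _ _ _).symm
      _ ≤ αr * K5 x y z t u := mul_le_mul_of_nonneg_right (hαr u) (hK50 x y z t u)
  calc ∑ x, ∑ y, ∑ z, ∑ w, ∑ u, |A u w| * K5 x y z t u ≤ ∑ x, ∑ y, ∑ z, αr * ∑ u, K5 x y z t u :=
        Finset.sum_le_sum fun _ _ => Finset.sum_le_sum fun _ _ => Finset.sum_le_sum fun _ _ => hin _ _ _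
    _ = αr * ∑ x, ∑ y, ∑ z, ∑ u, K5 x y z t u := by simp only [Finset.mul_sum]
    _ ≤ αr * k5s4 := mul_le_mul_of_nonneg_left (hk5s4 t) hαr0

end Masses

/-! ## §2. The two-point masters at the arities `m + n = 4` -/

section Arity

variable {D : κ → κ → ℝ} {dr dc c : ℝ}

omit [DecidableEq ι] [DecidableEq κ] in
/-- Two-point master, mass family on 3 indices against a column family on 1 indices, mass first. [folklore] -/
theorem master31 [Nonempty κ] {a : ι → ι → ι → κ → ℝ} {b : ι → κ → ℝ} {am bc : ℝ}
    (hD : ∀ x y, 0 ≤ D x y) (hDr : ∀ z, ∑ w, D z w ≤ dr) (hDc : ∀ w, ∑ z, D z w ≤ dc) (hcpos : 0 < c)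
    (ha : ∀ i1 i2 i3 z, 0 ≤ a i1 i2 i3 z) (hb : ∀ v1 z, 0 ≤ b v1 z) (ham : ∑ i1, ∑ i2, ∑ i3, ∑ z, a i1 i2 i3 z ≤ am)
    (hbc : ∀ z, ∑ v1, b v1 z ≤ bc) (hbc0 : 0 ≤ bc) :
    ∑ i1, ∑ i2, ∑ i3, ∑ v1, ∑ w, (∑ z', D z' w * a i1 i2 i3 z') * (∑ z', D z' w * b v1 z') / c ≤ am * bc * dr * dc / c := by
  have ham' : ∑ p : ι × ι × ι, ∑ z, a p.1 p.2.1 p.2.2 z ≤ am := by simp only [Fintype.sum_prod_type]; exact ham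
  have h := master_two_point (am := am) (bc := bc) (a := (fun p : ι × ι × ι => a p.1 p.2.1 p.2.2)) (b := b) hD hDr hDc hcpos (fun p z => ha _ _ _ z)
      hb
    ham' hbc hbc0
  simpa only [Fintype.sum_prod_type] using h

omit [DecidableEq ι] [DecidableEq κ] in
/-- Two-point master, mass family on 3 indices against a column family on 1 indices, column factor and column sums first. [folklore] -/
theorem master31_rev [Nonempty κ] {a : ι → ι → ι → κ → ℝ} {b : ι → κ → ℝ} {am bc : ℝ}
    (hD : ∀ x y, 0 ≤ D x y) (hDr : ∀ z, ∑ w, D z w ≤ dr) (hDc : ∀ w, ∑ z, D z w ≤ dc) (hcpos : 0 < c)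
    (ha : ∀ i1 i2 i3 z, 0 ≤ a i1 i2 i3 z) (hb : ∀ v1 z, 0 ≤ b v1 z) (ham : ∑ i1, ∑ i2, ∑ i3, ∑ z, a i1 i2 i3 z ≤ am)
    (hbc : ∀ z, ∑ v1, b v1 z ≤ bc) (hbc0 : 0 ≤ bc) :
    ∑ v1, ∑ i1, ∑ i2, ∑ i3, ∑ w, (∑ z', D z' w * b v1 z') * (∑ z', D z' w * a i1 i2 i3 z') / c ≤ am * bc * dr * dc / c := by
  have ham' : ∑ p : ι × ι × ι, ∑ z, a p.1 p.2.1 p.2.2 z ≤ am := by simp only [Fintype.sum_prod_type]; exact ham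
  have h := master_two_point_rev (am := am) (bc := bc) (a := (fun p : ι × ι × ι => a p.1 p.2.1 p.2.2)) (b := b) hD hDr hDc hcpos (fun p z => ha _ _ _
      z) hb
    ham' hbc hbc0
  simpa only [Fintype.sum_prod_type] using h

omit [DecidableEq ι] [DecidableEq κ] in
/-- Two-point master, mass family on 2 indices against a column family on 2 indices, mass first. [folklore] -/
theorem master22 [Nonempty κ] {a : ι → ι → κ → ℝ} {b : ι → ι → κ → ℝ} {am bc : ℝ}
    (hD : ∀ x y, 0 ≤ D x y) (hDr : ∀ z, ∑ w, D z w ≤ dr) (hDc : ∀ w, ∑ z, D z w ≤ dc) (hcpos : 0 < c)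
    (ha : ∀ i1 i2 z, 0 ≤ a i1 i2 z) (hb : ∀ v1 v2 z, 0 ≤ b v1 v2 z) (ham : ∑ i1, ∑ i2, ∑ z, a i1 i2 z ≤ am)
    (hbc : ∀ z, ∑ v1, ∑ v2, b v1 v2 z ≤ bc) (hbc0 : 0 ≤ bc) :
    ∑ i1, ∑ i2, ∑ v1, ∑ v2, ∑ w, (∑ z', D z' w * a i1 i2 z') * (∑ z', D z' w * b v1 v2 z') / c ≤ am * bc * dr * dc / c := by
  have ham' : ∑ p : ι × ι, ∑ z, a p.1 p.2 z ≤ am := by simp only [Fintype.sum_prod_type]; exact ham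
  have hbc' : ∀ z, ∑ p : ι × ι, b p.1 p.2 z ≤ bc := fun z => by simp only [Fintype.sum_prod_type]; exact hbc z
  have h := master_two_point (am := am) (bc := bc) (a := (fun p : ι × ι => a p.1 p.2)) (b := (fun p : ι × ι => b p.1 p.2)) hD hDr hDc hcpos (fun p z
      => ha _ _ z) (fun p z => hb _ _ z)
    ham' hbc' hbc0
  simpa only [Fintype.sum_prod_type] using h

omit [DecidableEq ι] [DecidableEq κ] in
/-- Two-point master, mass family on 2 indices against a column family on 2 indices, column factor and column sums first. [folklore] -/
theorem master22_rev [Nonempty κ] {a : ι → ι → κ → ℝ} {b : ι → ι → κ → ℝ} {am bc : ℝ}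
    (hD : ∀ x y, 0 ≤ D x y) (hDr : ∀ z, ∑ w, D z w ≤ dr) (hDc : ∀ w, ∑ z, D z w ≤ dc) (hcpos : 0 < c)
    (ha : ∀ i1 i2 z, 0 ≤ a i1 i2 z) (hb : ∀ v1 v2 z, 0 ≤ b v1 v2 z) (ham : ∑ i1, ∑ i2, ∑ z, a i1 i2 z ≤ am)
    (hbc : ∀ z, ∑ v1, ∑ v2, b v1 v2 z ≤ bc) (hbc0 : 0 ≤ bc) :
    ∑ v1, ∑ v2, ∑ i1, ∑ i2, ∑ w, (∑ z', D z' w * b v1 v2 z') * (∑ z', D z' w * a i1 i2 z') / c ≤ am * bc * dr * dc / c := by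
  have ham' : ∑ p : ι × ι, ∑ z, a p.1 p.2 z ≤ am := by simp only [Fintype.sum_prod_type]; exact ham
  have hbc' : ∀ z, ∑ p : ι × ι, b p.1 p.2 z ≤ bc := fun z => by simp only [Fintype.sum_prod_type]; exact hbc z
  have h := master_two_point_rev (am := am) (bc := bc) (a := (fun p : ι × ι => a p.1 p.2)) (b := (fun p : ι × ι => b p.1 p.2)) hD hDr hDc hcpos (fun
      p z => ha _ _ z) (fun p z => hb _ _ z)
    ham' hbc' hbc0
  simpa only [Fintype.sum_prod_type] using h

omit [DecidableEq ι] [DecidableEq κ] in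
/-- Two-point master, mass family on 1 indices against a column family on 3 indices, mass first. [folklore] -/
theorem master13 [Nonempty κ] {a : ι → κ → ℝ} {b : ι → ι → ι → κ → ℝ} {am bc : ℝ}
    (hD : ∀ x y, 0 ≤ D x y) (hDr : ∀ z, ∑ w, D z w ≤ dr) (hDc : ∀ w, ∑ z, D z w ≤ dc) (hcpos : 0 < c)
    (ha : ∀ i1 z, 0 ≤ a i1 z) (hb : ∀ v1 v2 v3 z, 0 ≤ b v1 v2 v3 z) (ham : ∑ i1, ∑ z, a i1 z ≤ am)
    (hbc : ∀ z, ∑ v1, ∑ v2, ∑ v3, b v1 v2 v3 z ≤ bc) (hbc0 : 0 ≤ bc) :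
    ∑ i1, ∑ v1, ∑ v2, ∑ v3, ∑ w, (∑ z', D z' w * a i1 z') * (∑ z', D z' w * b v1 v2 v3 z') / c ≤ am * bc * dr * dc / c := by
  have hbc' : ∀ z, ∑ p : ι × ι × ι, b p.1 p.2.1 p.2.2 z ≤ bc := fun z => by simp only [Fintype.sum_prod_type]; exact hbc z
  have h := master_two_point (am := am) (bc := bc) (a := a) (b := (fun p : ι × ι × ι => b p.1 p.2.1 p.2.2)) hD hDr hDc hcpos ha (fun p z => hb _ _ _
      z)
    ham hbc' hbc0
  simpa only [Fintype.sum_prod_type] using h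

omit [DecidableEq ι] [DecidableEq κ] in
/-- Two-point master, mass family on 1 indices against a column family on 3 indices, column factor and column sums first. [folklore] -/
theorem master13_rev [Nonempty κ] {a : ι → κ → ℝ} {b : ι → ι → ι → κ → ℝ} {am bc : ℝ}
    (hD : ∀ x y, 0 ≤ D x y) (hDr : ∀ z, ∑ w, D z w ≤ dr) (hDc : ∀ w, ∑ z, D z w ≤ dc) (hcpos : 0 < c)
    (ha : ∀ i1 z, 0 ≤ a i1 z) (hb : ∀ v1 v2 v3 z, 0 ≤ b v1 v2 v3 z) (ham : ∑ i1, ∑ z, a i1 z ≤ am)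
    (hbc : ∀ z, ∑ v1, ∑ v2, ∑ v3, b v1 v2 v3 z ≤ bc) (hbc0 : 0 ≤ bc) :
    ∑ v1, ∑ v2, ∑ v3, ∑ i1, ∑ w, (∑ z', D z' w * b v1 v2 v3 z') * (∑ z', D z' w * a i1 z') / c ≤ am * bc * dr * dc / c := by
  have hbc' : ∀ z, ∑ p : ι × ι × ι, b p.1 p.2.1 p.2.2 z ≤ bc := fun z => by simp only [Fintype.sum_prod_type]; exact hbc z
  have h := master_two_point_rev (am := am) (bc := bc) (a := a) (b := (fun p : ι × ι × ι => b p.1 p.2.1 p.2.2)) hD hDr hDc hcpos ha (fun p z => hb _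
      _ _ z)
    ham hbc' hbc0
  simpa only [Fintype.sum_prod_type] using h

omit [DecidableEq ι] [DecidableEq κ] in
/-- Two-point master, mass family on 0 indices (a single vector) against a column family on 4 indices, mass first. [folklore] -/
theorem master04 [Nonempty κ] {a : κ → ℝ} {b : ι → ι → ι → ι → κ → ℝ} {am bc : ℝ}
    (hD : ∀ x y, 0 ≤ D x y) (hDr : ∀ z, ∑ w, D z w ≤ dr) (hDc : ∀ w, ∑ z, D z w ≤ dc) (hcpos : 0 < c)
    (ha : ∀ z, 0 ≤ a z) (hb : ∀ v1 v2 v3 v4 z, 0 ≤ b v1 v2 v3 v4 z) (ham : ∑ z, a z ≤ am)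
    (hbc : ∀ z, ∑ v1, ∑ v2, ∑ v3, ∑ v4, b v1 v2 v3 v4 z ≤ bc) (hbc0 : 0 ≤ bc) :
     ∑ v1, ∑ v2, ∑ v3, ∑ v4, ∑ w, (∑ z', D z' w * a z') * (∑ z', D z' w * b v1 v2 v3 v4 z') / c ≤ am * bc * dr * dc / c := by
  have hbc' : ∀ z, ∑ p : ι × ι × ι × ι, b p.1 p.2.1 p.2.2.1 p.2.2.2 z ≤ bc := fun z => by simp only [Fintype.sum_prod_type]; exact hbc z
  have h := master_single' (am := am) (bc := bc) (a := a) (b := (fun p : ι × ι × ι × ι => b p.1 p.2.1 p.2.2.1 p.2.2.2)) hD hDr hDc hcpos ha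
    (fun p z => hb _ _ _ _ z) ham hbc' hbc0
  simpa only [Fintype.sum_prod_type] using h

omit [DecidableEq ι] [DecidableEq κ] in
/-- Two-point master, mass family on 0 indices (a single vector) against a column family on 4 indices, column factor and column sums first.
[folklore] -/
theorem master04_rev [Nonempty κ] {a : κ → ℝ} {b : ι → ι → ι → ι → κ → ℝ} {am bc : ℝ}
    (hD : ∀ x y, 0 ≤ D x y) (hDr : ∀ z, ∑ w, D z w ≤ dr) (hDc : ∀ w, ∑ z, D z w ≤ dc) (hcpos : 0 < c)
    (ha : ∀ z, 0 ≤ a z) (hb : ∀ v1 v2 v3 v4 z, 0 ≤ b v1 v2 v3 v4 z) (ham : ∑ z, a z ≤ am)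
    (hbc : ∀ z, ∑ v1, ∑ v2, ∑ v3, ∑ v4, b v1 v2 v3 v4 z ≤ bc) (hbc0 : 0 ≤ bc) :
    ∑ v1, ∑ v2, ∑ v3, ∑ v4,  ∑ w, (∑ z', D z' w * b v1 v2 v3 v4 z') * (∑ z', D z' w * a z') / c ≤ am * bc * dr * dc / c := by
  have hbc' : ∀ z, ∑ p : ι × ι × ι × ι, b p.1 p.2.1 p.2.2.1 p.2.2.2 z ≤ bc := fun z => by simp only [Fintype.sum_prod_type]; exact hbc z
  have h := master_single_rev' (am := am) (bc := bc) (a := a) (b := (fun p : ι × ι × ι × ι => b p.1 p.2.1 p.2.2.1 p.2.2.2)) hD hDr hDc hcpos ha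
    (fun p z => hb _ _ _ _ z) ham hbc' hbc0
  simpa only [Fintype.sum_prod_type] using h

end Arity

/-! ## §3. The remaining quadruple-sum reindexings -/

omit [DecidableEq ι] [Fintype κ] [DecidableEq κ] in
/-- `Σ_yΣ_zΣ_tΣ_s f(y,s,t,z) = Σ_yΣ_zΣ_tΣ_s f(y,z,t,s)` (reindexing of a quadruple site sum; one (595) lacks). [folklore] -/
theorem sum4_ystz (f : ι → ι → ι → ι → ℝ) : ∑ y, ∑ z, ∑ t, ∑ s, f y s t z = ∑ y, ∑ z, ∑ t, ∑ s, f y z t s := by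
  have h1 : ∑ y, ∑ z, ∑ t, ∑ s, f y s t z = ∑ y, ∑ z, ∑ t, ∑ s, f y s z t := Finset.sum_congr rfl fun _ _ => Finset.sum_comm
  have h2 : ∑ y, ∑ z, ∑ t, ∑ s, f y s z t = ∑ y, ∑ z, ∑ t, ∑ s, f y t z s := Finset.sum_congr rfl fun _ _ => Finset.sum_congr rfl fun _ _ =>
      Finset.sum_comm
  have h3 : ∑ y, ∑ z, ∑ t, ∑ s, f y t z s = ∑ y, ∑ z, ∑ t, ∑ s, f y z t s := Finset.sum_congr rfl fun _ _ => Finset.sum_comm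
  rw [h1, h2, h3]

omit [DecidableEq ι] [Fintype κ] [DecidableEq κ] in
/-- `Σ_yΣ_zΣ_tΣ_s f(z,s,t,y) = Σ_yΣ_zΣ_tΣ_s f(y,z,t,s)` (reindexing of a quadruple site sum; one (595) lacks). [folklore] -/
theorem sum4_zsty (f : ι → ι → ι → ι → ℝ) : ∑ y, ∑ z, ∑ t, ∑ s, f z s t y = ∑ y, ∑ z, ∑ t, ∑ s, f y z t s := by
  have h1 : ∑ y, ∑ z, ∑ t, ∑ s, f z s t y = ∑ y, ∑ z, ∑ t, ∑ s, f y s t z := Finset.sum_comm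
  have h2 : ∑ y, ∑ z, ∑ t, ∑ s, f y s t z = ∑ y, ∑ z, ∑ t, ∑ s, f y s z t := Finset.sum_congr rfl fun _ _ => Finset.sum_comm
  have h3 : ∑ y, ∑ z, ∑ t, ∑ s, f y s z t = ∑ y, ∑ z, ∑ t, ∑ s, f y t z s := Finset.sum_congr rfl fun _ _ => Finset.sum_congr rfl fun _ _ =>
      Finset.sum_comm
  have h4 : ∑ y, ∑ z, ∑ t, ∑ s, f y t z s = ∑ y, ∑ z, ∑ t, ∑ s, f y z t s := Finset.sum_congr rfl fun _ _ => Finset.sum_comm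
  rw [h1, h2, h3, h4]

omit [DecidableEq ι] [Fintype κ] [DecidableEq κ] in
/-- `Σ_yΣ_zΣ_tΣ_s f(t,z,y,s) = Σ_yΣ_zΣ_tΣ_s f(y,z,t,s)` (reindexing of a quadruple site sum; one (595) lacks). [folklore] -/
theorem sum4_tzys (f : ι → ι → ι → ι → ℝ) : ∑ y, ∑ z, ∑ t, ∑ s, f t z y s = ∑ y, ∑ z, ∑ t, ∑ s, f y z t s := by
  have h1 : ∑ y, ∑ z, ∑ t, ∑ s, f t z y s = ∑ y, ∑ z, ∑ t, ∑ s, f t y z s := Finset.sum_comm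
  have h2 : ∑ y, ∑ z, ∑ t, ∑ s, f t y z s = ∑ y, ∑ z, ∑ t, ∑ s, f z y t s := Finset.sum_congr rfl fun _ _ => Finset.sum_comm
  have h3 : ∑ y, ∑ z, ∑ t, ∑ s, f z y t s = ∑ y, ∑ z, ∑ t, ∑ s, f y z t s := Finset.sum_comm
  rw [h1, h2, h3]

omit [DecidableEq ι] [Fintype κ] [DecidableEq κ] in
/-- `Σ_yΣ_zΣ_tΣ_s f(t,s,z,y) = Σ_yΣ_zΣ_tΣ_s f(y,z,t,s)` (reindexing of a quadruple site sum; one (595) lacks). [folklore] -/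
theorem sum4_tszy (f : ι → ι → ι → ι → ℝ) : ∑ y, ∑ z, ∑ t, ∑ s, f t s z y = ∑ y, ∑ z, ∑ t, ∑ s, f y z t s := by
  have h1 : ∑ y, ∑ z, ∑ t, ∑ s, f t s z y = ∑ y, ∑ z, ∑ t, ∑ s, f t s y z := Finset.sum_comm
  have h2 : ∑ y, ∑ z, ∑ t, ∑ s, f t s y z = ∑ y, ∑ z, ∑ t, ∑ s, f z s y t := Finset.sum_congr rfl fun _ _ => Finset.sum_comm
  have h3 : ∑ y, ∑ z, ∑ t, ∑ s, f z s y t = ∑ y, ∑ z, ∑ t, ∑ s, f y s z t := Finset.sum_comm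
  have h4 : ∑ y, ∑ z, ∑ t, ∑ s, f y s z t = ∑ y, ∑ z, ∑ t, ∑ s, f y t z s := Finset.sum_congr rfl fun _ _ => Finset.sum_congr rfl fun _ _ =>
      Finset.sum_comm
  have h5 : ∑ y, ∑ z, ∑ t, ∑ s, f y t z s = ∑ y, ∑ z, ∑ t, ∑ s, f y z t s := Finset.sum_congr rfl fun _ _ => Finset.sum_comm
  rw [h1, h2, h3, h4, h5]

omit [DecidableEq ι] [Fintype κ] [DecidableEq κ] in
/-- `Σ_yΣ_zΣ_tΣ_s f(s,z,y,t) = Σ_yΣ_zΣ_tΣ_s f(y,z,t,s)` (reindexing of a quadruple site sum; one (595) lacks). [folklore] -/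
theorem sum4_szyt (f : ι → ι → ι → ι → ℝ) : ∑ y, ∑ z, ∑ t, ∑ s, f s z y t = ∑ y, ∑ z, ∑ t, ∑ s, f y z t s := by
  have h1 : ∑ y, ∑ z, ∑ t, ∑ s, f s z y t = ∑ y, ∑ z, ∑ t, ∑ s, f s y z t := Finset.sum_comm
  have h2 : ∑ y, ∑ z, ∑ t, ∑ s, f s y z t = ∑ y, ∑ z, ∑ t, ∑ s, f t y z s := Finset.sum_congr rfl fun _ _ => Finset.sum_congr rfl fun _ _ =>
      Finset.sum_comm
  have h3 : ∑ y, ∑ z, ∑ t, ∑ s, f t y z s = ∑ y, ∑ z, ∑ t, ∑ s, f z y t s := Finset.sum_congr rfl fun _ _ => Finset.sum_comm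
  have h4 : ∑ y, ∑ z, ∑ t, ∑ s, f z y t s = ∑ y, ∑ z, ∑ t, ∑ s, f y z t s := Finset.sum_comm
  rw [h1, h2, h3, h4]

omit [DecidableEq ι] [Fintype κ] [DecidableEq κ] in
/-- `Σ_yΣ_zΣ_tΣ_s f(s,t,y,z) = Σ_yΣ_zΣ_tΣ_s f(y,z,t,s)` (reindexing of a quadruple site sum; one (595) lacks). [folklore] -/
theorem sum4_styz (f : ι → ι → ι → ι → ℝ) : ∑ y, ∑ z, ∑ t, ∑ s, f s t y z = ∑ y, ∑ z, ∑ t, ∑ s, f y z t s := by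
  have h1 : ∑ y, ∑ z, ∑ t, ∑ s, f s t y z = ∑ y, ∑ z, ∑ t, ∑ s, f s z y t := Finset.sum_congr rfl fun _ _ => Finset.sum_comm
  have h2 : ∑ y, ∑ z, ∑ t, ∑ s, f s z y t = ∑ y, ∑ z, ∑ t, ∑ s, f s y z t := Finset.sum_comm
  have h3 : ∑ y, ∑ z, ∑ t, ∑ s, f s y z t = ∑ y, ∑ z, ∑ t, ∑ s, f t y z s := Finset.sum_congr rfl fun _ _ => Finset.sum_congr rfl fun _ _ =>
      Finset.sum_comm
  have h4 : ∑ y, ∑ z, ∑ t, ∑ s, f t y z s = ∑ y, ∑ z, ∑ t, ∑ s, f z y t s := Finset.sum_congr rfl fun _ _ => Finset.sum_comm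
  have h5 : ∑ y, ∑ z, ∑ t, ∑ s, f z y t s = ∑ y, ∑ z, ∑ t, ∑ s, f y z t s := Finset.sum_comm
  rw [h1, h2, h3, h4, h5]

omit [DecidableEq ι] [Fintype κ] [DecidableEq κ] in
/-- `Σ_yΣ_zΣ_tΣ_s f(s,t,z,y) = Σ_yΣ_zΣ_tΣ_s f(y,z,t,s)` (reindexing of a quadruple site sum; one (595) lacks). [folklore] -/
theorem sum4_stzy (f : ι → ι → ι → ι → ℝ) : ∑ y, ∑ z, ∑ t, ∑ s, f s t z y = ∑ y, ∑ z, ∑ t, ∑ s, f y z t s := by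
  have h1 : ∑ y, ∑ z, ∑ t, ∑ s, f s t z y = ∑ y, ∑ z, ∑ t, ∑ s, f s t y z := Finset.sum_comm
  have h2 : ∑ y, ∑ z, ∑ t, ∑ s, f s t y z = ∑ y, ∑ z, ∑ t, ∑ s, f s z y t := Finset.sum_congr rfl fun _ _ => Finset.sum_comm
  have h3 : ∑ y, ∑ z, ∑ t, ∑ s, f s z y t = ∑ y, ∑ z, ∑ t, ∑ s, f s y z t := Finset.sum_comm
  have h4 : ∑ y, ∑ z, ∑ t, ∑ s, f s y z t = ∑ y, ∑ z, ∑ t, ∑ s, f t y z s := Finset.sum_congr rfl fun _ _ => Finset.sum_congr rfl fun _ _ =>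
      Finset.sum_comm
  have h5 : ∑ y, ∑ z, ∑ t, ∑ s, f t y z s = ∑ y, ∑ z, ∑ t, ∑ s, f z y t s := Finset.sum_congr rfl fun _ _ => Finset.sum_comm
  have h6 : ∑ y, ∑ z, ∑ t, ∑ s, f z y t s = ∑ y, ∑ z, ∑ t, ∑ s, f y z t s := Finset.sum_comm
  rw [h1, h2, h3, h4, h5, h6]

/-- Toy (§3 on a concrete function). -/
example (f : ι → ι → ι → ι → ℝ) : ∑ y, ∑ z, ∑ t, ∑ s, f y s t z = ∑ y, ∑ z, ∑ t, ∑ s, f y z t s := sum4_ystz f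

end Summit.QuantumFields.BalabanUV.T4Continuum.NE7b.SupFifthKernelSlotMasters

end
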